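/-
Copyright (c) 2026. All rights reserved.
Released under Apache 2.0 license as described in the file LICENSE.
-/
import Literature.NumberTheory.ComplexMultiplication.CMTypeInducedFromPrimitive
import HarnessLib

/-!
# The `Aut(ℂ)`-pattern class of an embedding is the fibre over the primitive subfield; its size is `[M : K₁]`
# (Shimura 1998 §8.2; Streng 2010 Ch. I Lemma 3.5)

Layer `Literature/NumberTheory/ComplexMultiplication`; KERNEL ONLY (theorems; no definition, no named fact).

THE PRINT.  Shimura, *Abelian Varieties with Complex Multiplication and Modular Functions* (1998), §8.2, proof of
Prop. 26: for a CM type `(F; {φᵢ})` lifted to the Galois closure, `S = ⋃ᵢ φᵢ H₁`, `H' = {γ | Sγ = S}` and `K'` the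
subfield of `H'`, «the `φᵢ` induce a CM type on `K'`» and «`(F; {φᵢ})` is primitive if and only if `H₁ = H'`»; so
the embeddings of `F` with the same pattern as a given one form a coset of `H'/H₁`, of size `[H' : H₁] = [F : K']`.
Streng, *Complex multiplication of abelian surfaces* (2010), Ch. I Lemma 3.5 and (3.6): `Gal(L/K₁) = {σ | Φ_L σ = Φ_L}`.
The tree's `CMTypeInducedFromPrimitive` proves Lemma 3.5 with primitivity in the `Aut(ℂ)`-PATTERN form: embeddings
`s, t : K₁ → ℂ` with `τ ∘ s ∈ Φ₁ ⟺ τ ∘ t ∈ Φ₁` for all `τ ∈ Aut(ℂ)` coincide.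

WHAT IS PROVED (number field `M`, `Φ : CMType M`, a PRIMITIVE inducing sub-pair `(K₁, Φ₁)`,
`inducedCMType (algebraMap K₁ M) Φ₁ = Φ`):

* `setOf_pattern_eq_setOf_comp_eq` — **the pattern class of `s : M → ℂ`,
  `{t | ∀ τ ∈ Aut(ℂ), τ ∘ s ∈ Φ ⟺ τ ∘ t ∈ Φ}`, IS the fibre `{t | t|_{K₁} = s|_{K₁}}`** (⊇: membership in `Φ = Φ₁^M`
  reads on `K₁`; ⊆: the restrictions have the same pattern for `Φ₁`, so coincide by primitivity) — elementary, no
  Galois closure needed;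
* `ncard_setOf_comp_algebraMap_eq` — the fibre of `Hom(M, ℂ) → Hom(K₁, ℂ)` over any point has `[M : K₁]` elements
  (Mathlib `AlgHom.card`);
* `ncard_setOf_pattern_eq_finrank` — hence **every pattern class has exactly `[M : K₁]` elements**;
* `exists_primitive_inducedCMType_finrank_eq` — with the tree's existence theorem
  `exists_primitive_inducedCMType_eq`: if some pattern class of `Φ` has `n` elements, then `Φ` is induced from a
  primitive CM type on a subfield `K₁` with `[M : K₁] = n` (and `K₁` is the unique primitive subfield, tree
  `eq_of_primitive_of_inducedCMType_eq`).

Consumer: `HyperellipticJacobianTwoPowerNondegenerate` §7 (Emory–Goodson 2026 Prop. 3.2: at level `2^j` every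
pattern class of the lower-half type has `2` elements, so the primitive subfield `F_{j−1}` has index `2`).

## References
* [Shimura1998] G. Shimura, *Abelian Varieties with Complex Multiplication and Modular Functions*, Princeton Univ.
  Press (1998), §8.2 Prop. 26 and its proof.
* [Streng2010] M. Streng, *Complex multiplication of abelian surfaces*, PhD thesis, Leiden (2010), Ch. I Def. 3.2,
  Lemma 3.5 and (3.6).
* [MilneFT2022] J. S. Milne, *Fields and Galois Theory* (v5.10, 2022), Prop. 2.7 (a) (number of extensions of an
  embedding).

[topic NumberTheory/ComplexMultiplication]
-/

noncomputable section

namespace Literature.NumberTheory.ComplexMultiplication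

open Literature.AlgebraicGeometry.Motives (CMType)
open NumberField

variable {M : Type} [Field M] [NumberField M]

/-- Membership of `τ ∘ σ` in an induced type `Φ₁^M` depends only on `σ|_{K₁}`. [cite: Streng2010, Ch. I Def. 3.2] -/
theorem comp_mem_inducedCMType_iff_of_comp_eq (K₁ : IntermediateField ℚ M) (Φ₁ : CMType K₁) {s t : M →+* ℂ}
    (h : s.comp (algebraMap K₁ M) = t.comp (algebraMap K₁ M)) (τ : ℂ ≃+* ℂ) :
    (τ : ℂ →+* ℂ).comp s ∈ (inducedCMType (algebraMap K₁ M) Φ₁).1 ↔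
      (τ : ℂ →+* ℂ).comp t ∈ (inducedCMType (algebraMap K₁ M) Φ₁).1 := by
  rw [mem_inducedCMType_iff, mem_inducedCMType_iff, RingHom.comp_assoc, RingHom.comp_assoc, h]

/-- **The `Aut(ℂ)`-pattern class of an embedding is the fibre over the primitive subfield.**  If `Φ = Φ₁^M` with
`(K₁, Φ₁)` PRIMITIVE (pattern form), then for every `s : M → ℂ`,
`{t | ∀ τ ∈ Aut(ℂ), τ ∘ s ∈ Φ ⟺ τ ∘ t ∈ Φ} = {t | t|_{K₁} = s|_{K₁}}`: «the `φᵢ` induce a CM type on `K'`» and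
«primitive iff `H₁ = H'`». [cite: Shimura1998, §8.2 proof of Prop. 26] [cite: Streng2010, Ch. I Lemma 3.5 and (3.6)] -/
theorem setOf_pattern_eq_setOf_comp_eq (Φ : CMType M) {K₁ : IntermediateField ℚ M} (Φ₁ : CMType K₁)
    (h₁ : inducedCMType (algebraMap K₁ M) Φ₁ = Φ)
    (hp₁ : ∀ s t : K₁ →+* ℂ,
      (∀ τ : ℂ ≃+* ℂ, (τ : ℂ →+* ℂ).comp s ∈ Φ₁.1 ↔ (τ : ℂ →+* ℂ).comp t ∈ Φ₁.1) → s = t)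
    (s : M →+* ℂ) :
    {t : M →+* ℂ | ∀ τ : ℂ ≃+* ℂ, (τ : ℂ →+* ℂ).comp s ∈ Φ.1 ↔ (τ : ℂ →+* ℂ).comp t ∈ Φ.1} =
      {t | t.comp (algebraMap K₁ M) = s.comp (algebraMap K₁ M)} := by
  subst h₁
  ext t
  simp only [Set.mem_setOf_eq]
  constructor
  · intro hpat
    refine hp₁ _ _ fun τ => ?_
    rw [← RingHom.comp_assoc, ← RingHom.comp_assoc, ← mem_inducedCMType_iff, ← mem_inducedCMType_iff]
    exact (hpat τ).symm
  · intro h τ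
    exact comp_mem_inducedCMType_iff_of_comp_eq K₁ Φ₁ h.symm τ

/-- **`|fibre| = [M : K₁]`**: the embeddings `M → ℂ` with a prescribed restriction to a subfield `K₁` are the
`K₁`-algebra maps `M → ℂ` for that `K₁`-structure on `ℂ`, `[M : K₁]` in number (`M/K₁` separable, `ℂ` algebraically
closed; Mathlib `AlgHom.card`). [cite: MilneFT2022, Prop. 2.7 (a)] -/
theorem ncard_setOf_comp_algebraMap_eq (K₁ : IntermediateField ℚ M) (s : M →+* ℂ) :
    {t : M →+* ℂ | t.comp (algebraMap K₁ M) = s.comp (algebraMap K₁ M)}.ncard = Module.finrank K₁ M := by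
  classical
  letI : Algebra K₁ ℂ := (s.comp (algebraMap K₁ M)).toAlgebra
  haveI : Module.Finite K₁ M := Module.Finite.of_restrictScalars_finite ℚ K₁ M
  have e : {t : M →+* ℂ | t.comp (algebraMap K₁ M) = s.comp (algebraMap K₁ M)} ≃ (M →ₐ[K₁] ℂ) :=
    { toFun := fun t =>
        { toRingHom := t.1
          commutes' := fun r => RingHom.congr_fun t.2 r }
      invFun := fun ψ => ⟨ψ.toRingHom, ψ.comp_algebraMap⟩
      left_inv := fun t => rfl
      right_inv := fun ψ => rfl }
  rw [← Nat.card_coe_set_eq, Nat.card_congr e, Nat.card_eq_fintype_card, AlgHom.card]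

/-- **Every pattern class has exactly `[M : K₁]` elements**, `K₁` the primitive subfield of `Φ` (Shimura: the coset
`H'/H₁`, `[H' : H₁] = [F : K']`). [cite: Shimura1998, §8.2 proof of Prop. 26] [cite: Streng2010, Ch. I Lemma 3.5 and (3.6)] -/
theorem ncard_setOf_pattern_eq_finrank (Φ : CMType M) {K₁ : IntermediateField ℚ M} (Φ₁ : CMType K₁)
    (h₁ : inducedCMType (algebraMap K₁ M) Φ₁ = Φ)
    (hp₁ : ∀ s t : K₁ →+* ℂ,
      (∀ τ : ℂ ≃+* ℂ, (τ : ℂ →+* ℂ).comp s ∈ Φ₁.1 ↔ (τ : ℂ →+* ℂ).comp t ∈ Φ₁.1) → s = t)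
    (s : M →+* ℂ) :
    {t : M →+* ℂ | ∀ τ : ℂ ≃+* ℂ, (τ : ℂ →+* ℂ).comp s ∈ Φ.1 ↔ (τ : ℂ →+* ℂ).comp t ∈ Φ.1}.ncard =
      Module.finrank K₁ M := by
  rw [setOf_pattern_eq_setOf_comp_eq Φ Φ₁ h₁ hp₁ s, ncard_setOf_comp_algebraMap_eq K₁ s]

/-- **The index of the primitive subfield is the size of a pattern class**: if the pattern class of some embedding
`s` of `M` has `n` elements, then `Φ` is induced from a PRIMITIVE CM type `Φ₁` on a subfield `K₁` with `[M : K₁] = n`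
(existence: the tree's `exists_primitive_inducedCMType_eq`, Streng Lemma 3.5; the subfield is unique,
`eq_of_primitive_of_inducedCMType_eq`). [cite: Streng2010, Ch. I Lemma 3.5] [cite: Shimura1998, §8.2 Prop. 26] -/
theorem exists_primitive_inducedCMType_finrank_eq (Φ : CMType M) {s : M →+* ℂ} {n : ℕ}
    (hn : {t : M →+* ℂ | ∀ τ : ℂ ≃+* ℂ, (τ : ℂ →+* ℂ).comp s ∈ Φ.1 ↔ (τ : ℂ →+* ℂ).comp t ∈ Φ.1}.ncard = n) :
    ∃ (K₁ : IntermediateField ℚ M) (Φ₁ : CMType K₁),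
      inducedCMType (algebraMap K₁ M) Φ₁ = Φ ∧
      (∀ s t : K₁ →+* ℂ,
        (∀ τ : ℂ ≃+* ℂ, (τ : ℂ →+* ℂ).comp s ∈ Φ₁.1 ↔ (τ : ℂ →+* ℂ).comp t ∈ Φ₁.1) → s = t) ∧
      Module.finrank K₁ M = n := by
  obtain ⟨K₁, Φ₁, h₁, hp₁, -⟩ := exists_primitive_inducedCMType_eq Φ
  exact ⟨K₁, Φ₁, h₁, hp₁, by rw [← ncard_setOf_pattern_eq_finrank Φ Φ₁ h₁ hp₁ s, hn]⟩

end Literature.NumberTheory.ComplexMultiplication
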